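import Literature.Probability.RandomPlanarGeometry.SAWPulledLargeForceExpansionZdParity
import HarnessLib

/-!
# The pulled self-avoiding walk on `ℤ^{d+1}` at large force: `2d` DIVIDES EVERY COEFFICIENT `c_k^{(d)}` (`k ≥ 1`), in every dimension

Topic `Literature/Probability/RandomPlanarGeometry` (continues `SAWPulledLargeForceExpansionZdParity.lean`: the divisibility transfer
`CostSeries.dvd_e_of_dvd_census` (if `m` divides every census entry `N_{c,n}`, `c ≥ 1`, then `m ∣ e_k = c_k` for every `k ≥ 1`), the lateral
reflection `latNeg`, the force-coordinate lemmas `isBridge_congr_zero` / `isIrreducibleBridge_congr_zero`, and `costZd_eq_zero_of_latNeg_fixed`).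

PRINTED CONTEXT (locators only). Janse van Rensburg–Whittington 2013 §3.2 Theorem 8 (first order: `e^{λ_B} = y + 2d + O(1/y)` on `ℤ^{d+1}`, i.e.
`c₁^{(d)} = 2d`); Madras–Slade 1993 §1.2, §4.2. This file proves, STRUCTURALLY (no census value used), that the first-order factor `2d` divides
EVERY order: the lane's every-dimension polynomials `c₂^{(d)} = −2d`, `c₃^{(d)} = 2d(2d+1)`, `c₄^{(d)} = −4d²(2d+3)`, …, `c₁₂^{(d)} = −4d(512d¹⁰ + ⋯)`
all have the factor `2d`; here is why, for all `k`.

* §1 ★ `dvd_card_of_iterate_free` — ELEMENTARY ORBIT COUNTING: a self-map `f` of a finite set with `f^[m] = id` and `f^[k] x ≠ x` for `0 < k < m`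
  has all orbits of size `m`, so `m ∣ #S`.
* §2 the SIGNED ROTATION `rho` of the lateral axes of `ℤ^{d+2}`: `(x₀; x₁, …, x_{d+1}) ↦ (x₀; −x_{d+1}, x₁, …, x_d)` — additive, with inverse `rhoInv`,
  fixing the force coordinate, mapping the `2(d+1)` signed lateral unit vectors `latUnit j` (`j : ZMod (2(d+1))`) in ONE CYCLE: ★ `rho_latUnit :
  rho (latUnit j) = latUnit (j + 1)`, hence `rho^[k] (latUnit j) = latUnit (j + k)` and `rho^[2(d+1)] = id`; it preserves adjacency, self-avoiding walks,
  irreducible bridges and cost (`comp_rho_mem_irreducibleBridges_iff`, `costZd_comp_rho`).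
* §3 ★★ `two_mul_dvd_costCoeffZd`: **`2d ∣ N_{c,n}(ℤ^{d+1})` for every `c ≥ 1`** — an irreducible bridge of cost `≥ 1` has a LATERAL STEP
  (`exists_lateral_step`), a signed lateral unit vector, which `rho^[k]` (`0 < k < 2d`) moves; so the cyclic group of `rho` acts freely on the census class.
  ★★★ `two_mul_dvd_largeForceCoeffZd`: **`2d ∣ c_k^{(d)}` for every `k ≥ 1` and every `d`** (transfer lemma of the parity file with `m = 2d`).
[cite: JansevanRensburgWhittington2013, §3.2 Theorem 8 (arXiv v4 p. 11)] [cite: MadrasSlade1993, §4.2, eq. (4.2.20)–(4.2.22) (p. 94, 2013 reprint)]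
The definitions `rho`, `rhoInv`, `latUnit` are this file's tool notions; no number is taken from print.

Provenance: lane «pcv-sawmu», a-p3 g24 (2026-08-28). EDITION 1b: the two folklore orbit-counting helpers of §1 are `private` (lit-2 label).
-/

noncomputable section

open Finset
open scoped BigOperators
open Literature.Probability.LatticeModels
open Literature.Probability.RandomPlanarGeometry.SAW

namespace Literature.Probability.RandomPlanarGeometry.SAW.Zd

/-! ## §1 Elementary orbit counting -/

/-- Iterates of a map that preserves a set stay in the set. [folklore] -/
private theorem iterate_mem_of_mapsTo {β : Type*} {S : Finset β} {f : β → β} (hS : ∀ x ∈ S, f x ∈ S) :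
    ∀ (k : ℕ) {x : β}, x ∈ S → f^[k] x ∈ S
  | 0, _, hx => hx
  | k + 1, x, hx => by rw [Function.iterate_succ_apply]; exact iterate_mem_of_mapsTo hS k (hS x hx)

/-- ★ ORBIT COUNTING: if `f` maps the finite set `S` to itself, `f^[m] = id` on `S` (`m ≥ 1`) and no `f^[k]`, `0 < k < m`, fixes a point of `S`, then
`m ∣ #S` (every orbit has exactly `m` points). [folklore] -/
private theorem dvd_card_of_iterate_free {β : Type*} [DecidableEq β] (f : β → β) {m : ℕ} (hm : 1 ≤ m) :
    ∀ (S : Finset β), (∀ x ∈ S, f x ∈ S) → (∀ x ∈ S, f^[m] x = x) → (∀ x ∈ S, ∀ k, 0 < k → k < m → f^[k] x ≠ x) → m ∣ S.card := by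
  intro S
  induction S using Finset.strongInduction with
  | H S ih =>
    intro hS hper hfree
    rcases S.eq_empty_or_nonempty with rfl | ⟨x, hx⟩
    · simp
    · -- the orbit of `x`
      set O := (Finset.range m).image fun k => f^[k] x with hO
      have hOS : O ⊆ S := by
        intro y hy
        obtain ⟨k, -, rfl⟩ := Finset.mem_image.1 hy
        exact iterate_mem_of_mapsTo hS k hx
      -- `f` is injective on `S`, hence so are its iterates
      have key : ∀ w, f^[m - 1] (f w) = f^[m] w := fun w => by
        have h : f^[m - 1 + 1] w = f^[m - 1] (f w) := Function.iterate_succ_apply f (m - 1) w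
        rw [Nat.sub_add_cancel hm] at h
        exact h.symm
      have hinj : ∀ {y z}, y ∈ S → z ∈ S → f y = f z → y = z := by
        intro y z hy hz h
        have := congrArg (f^[m - 1]) h
        rwa [key, key, hper y hy, hper z hz] at this
      have hinjk : ∀ (k : ℕ) {y z}, y ∈ S → z ∈ S → f^[k] y = f^[k] z → y = z := by
        intro k
        induction k with
        | zero => intro y z _ _ h; exact h
        | succ k ihk =>
          intro y z hy hz h
          rw [Function.iterate_succ_apply, Function.iterate_succ_apply] at h
          exact hinj hy hz (ihk (hS y hy) (hS z hz) h)
      have aux : ∀ i j, i < j → j < m → f^[i] x = f^[j] x → False := by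
        intro i j hij hj h
        have h1 : f^[j] x = f^[i] (f^[j - i] x) := by rw [← Function.iterate_add_apply, show i + (j - i) = j by omega]
        have h2 : f^[j - i] x = x := hinjk i (iterate_mem_of_mapsTo hS _ hx) hx (by rw [← h1, h])
        exact hfree x hx (j - i) (by omega) (by omega) h2
      have hcardO : O.card = m := by
        rw [hO, Finset.card_image_of_injOn, Finset.card_range]
        intro i hi j hj hij
        simp only [Finset.coe_range, Set.mem_Iio] at hi hj
        simp only at hij
        by_contra hne
        rcases Nat.lt_or_gt_of_ne hne with hlt | hlt
        · exact aux i j hlt hj hij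
        · exact aux j i hlt hi hij.symm
      -- the complement is stable
      have hperk : ∀ q, f^[m * q] x = x := by
        intro q
        induction q with
        | zero => simp
        | succ q ihq => rw [Nat.mul_succ, Function.iterate_add_apply, hper x hx, ihq]
      have hmemO : ∀ k, f^[k] x ∈ O := by
        intro k
        refine Finset.mem_image.2 ⟨k % m, Finset.mem_range.2 (Nat.mod_lt _ (by omega)), ?_⟩
        have hk : f^[k] x = f^[k % m + m * (k / m)] x := by rw [Nat.mod_add_div k m]
        rw [hk, Function.iterate_add_apply, hperk]
      have hS' : ∀ y ∈ S \ O, f y ∈ S \ O := by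
        intro y hy
        obtain ⟨hyS, hyO⟩ := Finset.mem_sdiff.1 hy
        refine Finset.mem_sdiff.2 ⟨hS y hyS, fun hfy => hyO ?_⟩
        obtain ⟨k, -, hk⟩ := Finset.mem_image.1 hfy
        have : y = f^[m - 1] (f y) := by rw [key, hper y hyS]
        rw [this, ← hk, ← Function.iterate_add_apply]
        exact hmemO _
      have hlt : S \ O ⊂ S := Finset.sdiff_ssubset hOS ⟨x, Finset.mem_image.2 ⟨0, Finset.mem_range.2 (by omega), rfl⟩⟩
      have hdvd : m ∣ (S \ O).card :=
        ih _ hlt hS' (fun y hy => hper y (Finset.mem_sdiff.1 hy).1) (fun y hy => hfree y (Finset.mem_sdiff.1 hy).1)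
      rw [← Finset.card_sdiff_add_card_eq_card hOS, hcardO]
      exact dvd_add hdvd (dvd_refl m)

/-! ## §2 The signed rotation of the lateral axes of `ℤ^{d+2}` -/

variable (d : ℕ)

/-- The signed rotation of the `d + 1` lateral axes of `ℤ^{d+2}`: `(x₀; x₁, …, x_{d+1}) ↦ (x₀; −x_{d+1}, x₁, …, x_d)`. [cite: MadrasSlade1993, §4.2, eq. (4.2.20)–(4.2.22) (p. 94, 2013 reprint)] -/
def rho (x : Site (d + 2)) : Site (d + 2) := fun a =>
  if a = 0 then x 0 else if a = 1 then -x (Fin.last (d + 1)) else x (a - 1)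

/-- The inverse rotation: `(x₀; x₁, …, x_{d+1}) ↦ (x₀; x₂, …, x_{d+1}, −x₁)`. [cite: MadrasSlade1993, §4.2, eq. (4.2.20)–(4.2.22) (p. 94, 2013 reprint)] -/
def rhoInv (x : Site (d + 2)) : Site (d + 2) := fun a =>
  if a = 0 then x 0 else if a = Fin.last (d + 1) then -x 1 else x (a + 1)

/-- The force coordinate is unchanged. [cite: MadrasSlade1993, §4.2, eq. (4.2.20)–(4.2.22) (p. 94, 2013 reprint)] -/
@[simp] theorem rho_apply_zero (x : Site (d + 2)) : rho d x 0 = x 0 := by simp [rho]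

/-- `rhoInv` is a left inverse of `rho`. [cite: MadrasSlade1993, §4.2, eq. (4.2.20)–(4.2.22) (p. 94, 2013 reprint)] -/
theorem rhoInv_rho (x : Site (d + 2)) : rhoInv d (rho d x) = x := by
  funext a
  by_cases ha0 : a = 0
  · subst ha0; simp [rhoInv, rho]
  by_cases hal : a = Fin.last (d + 1)
  · subst hal
    have h1 : (1 : Fin (d + 2)) ≠ 0 := by simp
    simp only [rhoInv, rho, ha0, if_false, if_true, h1, neg_neg]
  · have hne : a + 1 ≠ 0 := by
      intro h
      apply hal
      rw [Fin.ext_iff, Fin.val_last]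
      have := congrArg Fin.val h
      rw [Fin.val_add, Fin.val_one, Fin.val_zero] at this
      have ha := a.isLt
      rcases Nat.lt_or_ge (a.val + 1) (d + 2) with hl | hl
      · rw [Nat.mod_eq_of_lt hl] at this; omega
      · omega
    have hne1 : a + 1 ≠ 1 := by
      intro h; apply ha0
      have := congrArg (fun z => z - 1) h
      simpa using this
    simp only [rhoInv, rho, ha0, hal, if_false, hne, hne1, add_sub_cancel_right]

/-- `rho` is injective. [cite: MadrasSlade1993, §4.2, eq. (4.2.20)–(4.2.22) (p. 94, 2013 reprint)] -/
theorem rho_injective : Function.Injective (rho d) := fun x y h => by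
  simpa [rhoInv_rho] using congrArg (rhoInv d) h

/-- `rho` is additive. [cite: MadrasSlade1993, §4.2, eq. (4.2.20)–(4.2.22) (p. 94, 2013 reprint)] -/
theorem rho_add (x y : Site (d + 2)) : rho d (x + y) = rho d x + rho d y := by
  funext a
  by_cases ha0 : a = 0
  · simp [rho, ha0]
  · by_cases ha1 : a = 1
    · simp [rho, ha1]; ring
    · simp [rho, ha0, ha1]

/-- `rho` of a difference. [cite: MadrasSlade1993, §4.2, eq. (4.2.20)–(4.2.22) (p. 94, 2013 reprint)] -/
theorem rho_sub (x y : Site (d + 2)) : rho d (x - y) = rho d x - rho d y := by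
  funext a
  by_cases ha0 : a = 0
  · simp [rho, ha0]
  · by_cases ha1 : a = 1
    · simp [rho, ha1]; ring
    · simp [rho, ha0, ha1]

/-- `rho` commutes with integer scaling. [cite: MadrasSlade1993, §4.2, eq. (4.2.20)–(4.2.22) (p. 94, 2013 reprint)] -/
theorem rho_zsmul (n : ℤ) (x : Site (d + 2)) : rho d (n • x) = n • rho d x := by
  funext a
  by_cases ha0 : a = 0
  · simp [rho, ha0]
  · by_cases ha1 : a = 1
    · simp [rho, ha1]
    · simp [rho, ha0, ha1]

/-- Iterates of `rho` are additive. [cite: MadrasSlade1993, §4.2, eq. (4.2.20)–(4.2.22) (p. 94, 2013 reprint)] -/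
theorem rho_iterate_sub (k : ℕ) (x y : Site (d + 2)) : (rho d)^[k] (x - y) = (rho d)^[k] x - (rho d)^[k] y := by
  induction k generalizing x y with
  | zero => rfl
  | succ k ih => rw [Function.iterate_succ_apply, Function.iterate_succ_apply, Function.iterate_succ_apply, rho_sub, ih]

/-- `rho 0 = 0`. [cite: MadrasSlade1993, §4.2, eq. (4.2.20)–(4.2.22) (p. 94, 2013 reprint)] -/
@[simp] theorem rho_zero : rho d (0 : Site (d + 2)) = 0 := by
  funext a
  by_cases ha0 : a = 0
  · simp [rho, ha0]
  · by_cases ha1 : a = 1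
    · simp [rho, ha1]
    · simp [rho, ha0, ha1]

/-- Iterates of `rho` on finite sums of scaled vectors. [cite: MadrasSlade1993, §4.2, eq. (4.2.20)–(4.2.22) (p. 94, 2013 reprint)] -/
theorem rho_iterate_sum_zsmul (k : ℕ) {ι : Type*} (s : Finset ι) (n : ι → ℤ) (v : ι → Site (d + 2)) :
    (rho d)^[k] (∑ i ∈ s, n i • v i) = ∑ i ∈ s, n i • (rho d)^[k] (v i) := by
  induction k with
  | zero => rfl
  | succ k ih =>
    rw [Function.iterate_succ_apply', ih]
    have hadd : ∀ (t : Finset ι) (g : ι → Site (d + 2)), rho d (∑ i ∈ t, g i) = ∑ i ∈ t, rho d (g i) := by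
      classical
      intro t g
      induction t using Finset.induction_on with
      | empty => simp
      | insert i t hi iht => rw [Finset.sum_insert hi, Finset.sum_insert hi, rho_add, iht]
    rw [hadd]
    refine Finset.sum_congr rfl fun i _ => ?_
    rw [rho_zsmul, Function.iterate_succ_apply']

/-! ### The `2(d+1)` signed lateral unit vectors as one cycle of `rho` -/

/-- The signed lateral unit vectors, indexed by `ZMod (2(d+1))`: `j ↦ +e_{j+1}` for `j ≤ d`, `j ↦ −e_{j−d}` for `d + 1 ≤ j ≤ 2d + 1`.
[cite: MadrasSlade1993, §4.2, eq. (4.2.20)–(4.2.22) (p. 94, 2013 reprint)] -/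
def latUnit (j : ZMod (2 * (d + 1))) : Site (d + 2) :=
  if h : j.val < d + 1 then Pi.single (⟨j.val + 1, by omega⟩ : Fin (d + 2)) 1
  else -Pi.single (⟨min (j.val - d) (d + 1), by omega⟩ : Fin (d + 2)) 1

/-- Coordinates of a signed lateral unit vector. [cite: MadrasSlade1993, §4.2, eq. (4.2.20)–(4.2.22) (p. 94, 2013 reprint)] -/
theorem latUnit_apply (j : ZMod (2 * (d + 1))) (b : Fin (d + 2)) :
    latUnit d j b = if j.val < d + 1 then (if b.val = j.val + 1 then 1 else 0) else (if b.val = j.val - d then -1 else 0) := by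
  haveI : NeZero (2 * (d + 1)) := ⟨by omega⟩
  have hjlt := j.val_lt
  unfold latUnit
  by_cases hj : j.val < d + 1
  · rw [dif_pos hj, if_pos hj, Pi.single_apply]
    simp only [Fin.ext_iff]
  · have hmin : min (j.val - d) (d + 1) = j.val - d := Nat.min_eq_left (by omega)
    rw [dif_neg hj, if_neg hj, Pi.neg_apply, Pi.single_apply]
    simp only [Fin.ext_iff, hmin]
    split_ifs <;> simp

/-- The force coordinate of a signed lateral unit vector is `0`. [cite: MadrasSlade1993, §4.2, eq. (4.2.20)–(4.2.22) (p. 94, 2013 reprint)] -/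
@[simp] theorem latUnit_apply_zero (j : ZMod (2 * (d + 1))) : latUnit d j 0 = 0 := by
  haveI : NeZero (2 * (d + 1)) := ⟨by omega⟩
  have hjlt := j.val_lt
  rw [latUnit_apply]
  by_cases hj : j.val < d + 1
  · rw [if_pos hj, if_neg (by simp)]
  · rw [if_neg hj, if_neg (by simp only [Fin.val_zero]; omega)]

/-- A signed lateral unit vector is not zero. [cite: MadrasSlade1993, §4.2, eq. (4.2.20)–(4.2.22) (p. 94, 2013 reprint)] -/
theorem latUnit_ne_zero (j : ZMod (2 * (d + 1))) : latUnit d j ≠ 0 := by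
  haveI : NeZero (2 * (d + 1)) := ⟨by omega⟩
  have hjlt := j.val_lt
  intro h
  by_cases hj : j.val < d + 1
  · have := congrFun h ⟨j.val + 1, by omega⟩
    rw [latUnit_apply, if_pos hj] at this
    simp at this
  · have := congrFun h ⟨j.val - d, by omega⟩
    rw [latUnit_apply, if_neg hj] at this
    simp at this

/-- A positive lateral unit vector as a `latUnit`. [cite: MadrasSlade1993, §4.2, eq. (4.2.20)–(4.2.22) (p. 94, 2013 reprint)] -/
theorem single_eq_latUnit (a : Fin (d + 2)) (ha : a ≠ 0) :
    Pi.single (M := fun _ => ℤ) a (1 : ℤ) = latUnit d (((a.val - 1 : ℕ)) : ZMod (2 * (d + 1))) := by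
  haveI : NeZero (2 * (d + 1)) := ⟨by omega⟩
  have halt := a.isLt
  have hav : 1 ≤ a.val := by
    rcases Nat.eq_zero_or_pos a.val with h | h
    · exact absurd (Fin.ext h) ha
    · exact h
  have hv : (((a.val - 1 : ℕ)) : ZMod (2 * (d + 1))).val = a.val - 1 := by
    rw [ZMod.val_natCast, Nat.mod_eq_of_lt (by omega)]
  funext b
  rw [latUnit_apply, if_pos (show (((a.val - 1 : ℕ)) : ZMod (2 * (d + 1))).val < d + 1 by rw [hv]; omega), Pi.single_apply]
  simp only [Fin.ext_iff, hv]
  split_ifs with h1 h2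
  all_goals omega

/-- A negative lateral unit vector as a `latUnit`. [cite: MadrasSlade1993, §4.2, eq. (4.2.20)–(4.2.22) (p. 94, 2013 reprint)] -/
theorem neg_single_eq_latUnit (a : Fin (d + 2)) (ha : a ≠ 0) :
    -Pi.single (M := fun _ => ℤ) a (1 : ℤ) = latUnit d (((a.val - 1 + (d + 1) : ℕ)) : ZMod (2 * (d + 1))) := by
  haveI : NeZero (2 * (d + 1)) := ⟨by omega⟩
  have halt := a.isLt
  have hav : 1 ≤ a.val := by
    rcases Nat.eq_zero_or_pos a.val with h | h
    · exact absurd (Fin.ext h) ha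
    · exact h
  have hv : (((a.val - 1 + (d + 1) : ℕ)) : ZMod (2 * (d + 1))).val = a.val - 1 + (d + 1) := by
    rw [ZMod.val_natCast, Nat.mod_eq_of_lt (by omega)]
  funext b
  rw [latUnit_apply, if_neg (show ¬ (((a.val - 1 + (d + 1) : ℕ)) : ZMod (2 * (d + 1))).val < d + 1 by rw [hv]; omega),
    Pi.neg_apply, Pi.single_apply]
  simp only [Fin.ext_iff, hv]
  split_ifs with h1 h2
  all_goals omega

/-- Every lateral unit vector `± e_a` (`a ≠ 0`) is some `latUnit`. [cite: MadrasSlade1993, §4.2, eq. (4.2.20)–(4.2.22) (p. 94, 2013 reprint)] -/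
theorem exists_latUnit_of_ne_zero (a : Fin (d + 2)) (ha : a ≠ 0) :
    (∃ j, Pi.single (M := fun _ => ℤ) a (1 : ℤ) = latUnit d j) ∧ ∃ j, -Pi.single (M := fun _ => ℤ) a (1 : ℤ) = latUnit d j :=
  ⟨⟨_, single_eq_latUnit d a ha⟩, ⟨_, neg_single_eq_latUnit d a ha⟩⟩

/-- ★ THE CYCLE: `rho` sends each signed lateral unit vector to the next one. [cite: MadrasSlade1993, §4.2, eq. (4.2.20)–(4.2.22) (p. 94, 2013 reprint)] -/
theorem rho_latUnit (j : ZMod (2 * (d + 1))) : rho d (latUnit d j) = latUnit d (j + 1) := by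
  haveI : NeZero (2 * (d + 1)) := ⟨by omega⟩
  haveI : Fact (1 < 2 * (d + 1)) := ⟨by omega⟩
  have hjlt := j.val_lt
  have hval : (j + 1 : ZMod (2 * (d + 1))).val = if j.val + 1 < 2 * (d + 1) then j.val + 1 else 0 := by
    rw [ZMod.val_add, ZMod.val_one]
    split_ifs with h
    · exact Nat.mod_eq_of_lt h
    · rw [show j.val + 1 = 2 * (d + 1) by omega, Nat.mod_self]
  funext a
  by_cases ha0 : a = 0
  · subst ha0
    rw [rho_apply_zero, latUnit_apply_zero, latUnit_apply_zero]
  · by_cases ha1 : a = 1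
    · subst ha1
      have h1 : (1 : Fin (d + 2)) ≠ 0 := by simp
      simp only [rho, if_neg h1, if_true]
      rw [latUnit_apply, latUnit_apply]
      simp only [Fin.val_last, Fin.val_one, hval]
      split_ifs <;> omega
    · simp only [rho, if_neg ha0, if_neg ha1]
      rw [latUnit_apply, latUnit_apply]
      have hle : (1 : Fin (d + 2)) ≤ a := by
        rw [Fin.le_def, Fin.val_one]
        rcases Nat.eq_zero_or_pos a.val with h | h
        · exact absurd (Fin.ext h) ha0
        · exact h
      have hsub : ((a - 1 : Fin (d + 2)) : ℕ) = (a : ℕ) - 1 := by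
        rw [Fin.coe_sub_iff_le.2 hle, Fin.val_one]
      have ha1' : (a : ℕ) ≠ 1 := fun h => ha1 (Fin.ext (by rw [h]; simp))
      have halt := a.isLt
      simp only [hsub, hval]
      split_ifs <;> omega

/-- Iterates of `rho` advance the cycle. [cite: MadrasSlade1993, §4.2, eq. (4.2.20)–(4.2.22) (p. 94, 2013 reprint)] -/
theorem rho_iterate_latUnit (k : ℕ) (j : ZMod (2 * (d + 1))) : (rho d)^[k] (latUnit d j) = latUnit d (j + k) := by
  induction k generalizing j with
  | zero => simp
  | succ k ih => rw [Function.iterate_succ_apply, rho_latUnit, ih]; push_cast; ring_nf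

/-- `latUnit` is injective. [cite: MadrasSlade1993, §4.2, eq. (4.2.20)–(4.2.22) (p. 94, 2013 reprint)] -/
theorem latUnit_injective : Function.Injective (latUnit d) := by
  intro i j h
  haveI : NeZero (2 * (d + 1)) := ⟨by omega⟩
  have hi := i.val_lt; have hj := j.val_lt
  apply ZMod.val_injective
  by_cases hi1 : i.val < d + 1
  · have := congrFun h ⟨i.val + 1, by omega⟩
    rw [latUnit_apply, latUnit_apply, if_pos hi1] at this
    simp only [if_true] at this
    split_ifs at this
    all_goals omega
  · have := congrFun h ⟨i.val - d, by omega⟩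
    rw [latUnit_apply, latUnit_apply, if_neg hi1] at this
    simp only [if_true] at this
    split_ifs at this
    all_goals omega

/-- ★ For `0 < k < 2(d+1)` the iterate `rho^[k]` moves every signed lateral unit vector. [cite: MadrasSlade1993, §4.2, eq. (4.2.20)–(4.2.22) (p. 94, 2013 reprint)] -/
theorem rho_iterate_latUnit_ne {k : ℕ} (hk : 0 < k) (hk2 : k < 2 * (d + 1)) (j : ZMod (2 * (d + 1))) :
    (rho d)^[k] (latUnit d j) ≠ latUnit d j := by
  rw [rho_iterate_latUnit]
  intro h
  have h' := latUnit_injective d h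
  have : ((k : ℕ) : ZMod (2 * (d + 1))) = 0 := by simpa using h'
  rw [ZMod.natCast_eq_zero_iff] at this
  exact absurd (Nat.le_of_dvd hk this) (by omega)

/-- `rho^[2(d+1)]` is the identity. [cite: MadrasSlade1993, §4.2, eq. (4.2.20)–(4.2.22) (p. 94, 2013 reprint)] -/
theorem rho_iterate_two_mul (x : Site (d + 2)) : (rho d)^[2 * (d + 1)] x = x := by
  classical
  -- decompose `x` along the basis: `x = x₀ e₀ + Σ_{b ≥ 1} x_b e_b`, and `e_b = latUnit (b-1)` for `b ≥ 1`
  have hx : x = ∑ a : Fin (d + 2), x a • Pi.single (M := fun _ => ℤ) a (1 : ℤ) := by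
    simpa using pi_eq_sum_univ' x
  have he0 : ∀ k, (rho d)^[k] (Pi.single (0 : Fin (d + 2)) (1 : ℤ)) = Pi.single 0 1 := by
    intro k
    induction k with
    | zero => rfl
    | succ k ih =>
      rw [Function.iterate_succ_apply', ih]
      funext a; by_cases ha0 : a = 0
      · subst ha0; simp [rho]
      · by_cases ha1 : a = 1
        · subst ha1; simp [rho]
        · have : a - 1 ≠ 0 := fun h => ha1 (sub_eq_zero.1 h)
          simp [rho, ha0, ha1, this]
  have heb : ∀ a : Fin (d + 2), a ≠ 0 → ∃ j, Pi.single (M := fun _ => ℤ) a (1 : ℤ) = latUnit d j :=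
    fun a ha => (exists_latUnit_of_ne_zero d a ha).1
  conv_lhs => rw [hx]
  rw [rho_iterate_sum_zsmul]
  conv_rhs => rw [hx]
  refine Finset.sum_congr rfl fun a _ => ?_
  by_cases ha : a = 0
  · subst ha; rw [he0]
  · obtain ⟨j, hj⟩ := heb a ha
    rw [hj, rho_iterate_latUnit]
    congr 1
    have : ((2 * (d + 1) : ℕ) : ZMod (2 * (d + 1))) = 0 := ZMod.natCast_self _
    rw [this, add_zero]

/-! ### `rho` on the lattice, walks and bridges -/

/-- `rho` preserves adjacency. [cite: MadrasSlade1993, §4.2, eq. (4.2.20)–(4.2.22) (p. 94, 2013 reprint)] -/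
theorem zdGraph_adj_rho {x y : Site (d + 2)} (h : (zdGraph (d + 2)).Adj x y) : (zdGraph (d + 2)).Adj (rho d x) (rho d y) := by
  classical
  rw [zdGraph_adj_iff] at h ⊢
  -- the step `y - x = ± e_i`
  have key : ∀ i : Fin (d + 2), ∃ i', rho d (Pi.single i 1) = Pi.single i' 1 ∨ rho d (Pi.single i 1) = -Pi.single i' 1 := by
    intro i
    by_cases hi : i = 0
    · refine ⟨0, Or.inl ?_⟩
      subst hi; funext a
      by_cases ha0 : a = 0
      · subst ha0; simp [rho]
      · by_cases ha1 : a = 1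
        · subst ha1; simp [rho]
        · have : a - 1 ≠ 0 := fun h => ha1 (sub_eq_zero.1 h)
          simp [rho, ha0, ha1, this]
    · -- a lateral unit vector is some `latUnit j`, and `rho (latUnit j) = latUnit (j+1)` is again `± e_{i'}`
      obtain ⟨j, hij⟩ := (exists_latUnit_of_ne_zero d i hi).1
      rw [hij, rho_latUnit]
      unfold latUnit
      split_ifs with hc
      · exact ⟨_, Or.inl rfl⟩
      · exact ⟨_, Or.inr rfl⟩
  obtain ⟨i, hi | hi⟩ := h
  · obtain ⟨i', h1 | h1⟩ := key i
    · exact ⟨i', Or.inl (by rw [hi, rho_add, h1])⟩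
    · exact ⟨i', Or.inr (by rw [hi, rho_add, h1]; abel)⟩
  · obtain ⟨i', h1 | h1⟩ := key i
    · exact ⟨i', Or.inr (by rw [hi, rho_add, h1])⟩
    · exact ⟨i', Or.inl (by rw [hi, rho_add, h1]; abel)⟩

/-- `rho` maps self-avoiding walks to self-avoiding walks. [cite: MadrasSlade1993, §1.1] -/
theorem comp_rho_mem_saws {n : ℕ} {ω : ℕ → Site (d + 2)} (h : ω ∈ saws (d + 2) n) : (fun i => rho d (ω i)) ∈ saws (d + 2) n := by
  obtain ⟨h0, hc, hadj, hinj⟩ := mem_saws.1 h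
  refine mem_saws.2 ⟨?_, fun i hi => by simp only [hc i hi], fun i hi => zdGraph_adj_rho d (hadj i hi),
    fun i hi j hj hij => hinj hi hj (rho_injective d hij)⟩
  rw [h0]; funext a
  by_cases ha0 : a = 0 <;> by_cases ha1 : a = 1 <;> simp [rho, ha0, ha1]

/-- Iterates of `rho` map self-avoiding walks to self-avoiding walks. [cite: MadrasSlade1993, §1.1] -/
theorem comp_rho_iterate_mem_saws (k : ℕ) {n : ℕ} : ∀ {ω : ℕ → Site (d + 2)}, ω ∈ saws (d + 2) n →
    (fun i => (rho d)^[k] (ω i)) ∈ saws (d + 2) n := by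
  induction k with
  | zero => intro ω h; exact h
  | succ k ih => intro ω h; simpa only [Function.iterate_succ_apply'] using comp_rho_mem_saws d (ih h)

/-- ★ `rho` maps irreducible bridges to irreducible bridges (the force coordinate is untouched). [cite: DuminilCopinHammond2013, §2.2] -/
theorem comp_rho_mem_irreducibleBridges {n : ℕ} {ω : ℕ → Site (d + 2)} (h : ω ∈ irreducibleBridges (d + 2) n) :
    (fun i => rho d (ω i)) ∈ irreducibleBridges (d + 2) n := by
  have h0 : ∀ i, (fun i => rho d (ω i)) i 0 = ω i 0 := fun i => rho_apply_zero d (ω i)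
  rw [mem_irreducibleBridges, mem_bridges] at h ⊢
  exact ⟨⟨comp_rho_mem_saws d h.1.1, (isBridge_congr_zero h0).2 h.1.2⟩, (isIrreducibleBridge_congr_zero h0).2 h.2⟩

/-- The cost is unchanged by `rho`. [cite: MadrasSlade1993, §4.2, eq. (4.2.20)–(4.2.22) (p. 94, 2013 reprint)] -/
@[simp] theorem costZd_comp_rho (n : ℕ) (ω : ℕ → Site (d + 2)) : costZd (d + 1) n (fun i => rho d (ω i)) = costZd (d + 1) n ω := by
  simp [costZd]

/-! ## §3 A lateral step, and the divisibility by `2d` -/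

/-- ★ An irreducible bridge of cost `≥ 1` has a LATERAL STEP: a step along a signed lateral unit vector. [cite: DuminilCopinHammond2013, §2.2] -/
theorem exists_lateral_step {n : ℕ} {ω : ℕ → Site (d + 2)} (hω : ω ∈ irreducibleBridges (d + 2) n) (hc : 1 ≤ costZd (d + 1) n ω) :
    ∃ i < n, ∃ j, ω (i + 1) - ω i = latUnit d j := by
  classical
  obtain ⟨hbr, hI⟩ := mem_irreducibleBridges.1 hω
  obtain ⟨hωs, hb⟩ := mem_bridges.1 hbr
  obtain ⟨h0, -, hadj, -⟩ := mem_saws.1 hωs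
  have hn1 : 1 ≤ n := hI.1
  by_contra hno
  push Not at hno
  -- then every step is vertical
  have hstep : ∀ i < n, ω (i + 1) 0 = ω i 0 + 1 ∨ ω (i + 1) 0 = ω i 0 - 1 := by
    intro i hi
    obtain ⟨a, ha | ha⟩ := (zdGraph_adj_iff _ _).1 (hadj i hi)
    · by_cases ha0 : a = 0
      · subst ha0; left; rw [ha]; simp
      · exfalso
        obtain ⟨j, hj⟩ := (exists_latUnit_of_ne_zero d a ha0).1
        exact hno i hi j (by rw [ha, add_sub_cancel_left, hj])
    · by_cases ha0 : a = 0
      · subst ha0; right; have := congrFun ha 0; simp at this; omega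
      · exfalso
        obtain ⟨j, hj⟩ := (exists_latUnit_of_ne_zero d a ha0).2
        have hsub : ω (i + 1) - ω i = -Pi.single a 1 := by rw [ha]; abel
        exact hno i hi j (by rw [hsub, hj])
  -- a vertical self-avoiding bridge is the single up-step
  have hup : ∀ i < n, ω (i + 1) 0 = ω i 0 + 1 := by
    intro i
    induction i with
    | zero => intro _; rw [apply_one_eq_e0_of_mem_bridges (d + 1) hn1 hbr, h0]; simp
    | succ i ih =>
      intro hi
      rcases hstep (i + 1) hi with h | h
      · exact h
      · exact (no_up_down_of_mem_saws (d + 1) hωs (by omega) (ih (by omega)) h).elim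
  have hmono : ∀ i < n, ω i 0 ≤ ω (i + 1) 0 := fun i hi => by rw [hup i hi]; omega
  have hh : ∀ i ≤ n, ω i 0 = i := by
    intro i
    induction i with
    | zero => intro _; rw [h0]; rfl
    | succ i ih => intro hi; rw [hup i (by omega), ih (by omega)]; push_cast; ring
  have hn : n = 1 := by
    by_contra hne
    exact not_irreducible_of_monotone (d + 1) hω hmono (by rw [hh n le_rfl]; omega)
  subst hn
  have : costZd (d + 1) 1 ω = 0 := by rw [costZd, hh 1 le_rfl]; rfl
  omega

/-- ★★ **`2d ∣ N_{c,n}(ℤ^{d+1})` FOR EVERY `c ≥ 1`** — written for `ℤ^{d+2}` (`d + 1` lateral axes): the cyclic group of the signed rotation acts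
freely on the census class. [cite: MadrasSlade1993, §4.2, eq. (4.2.20)–(4.2.22) (p. 94, 2013 reprint)] -/
theorem two_mul_dvd_costCoeffZd_succ {c : ℕ} (hc : 1 ≤ c) (n : ℕ) : 2 * (d + 1) ∣ costCoeffZd (d + 1) c n := by
  classical
  rw [costCoeffZd]
  refine dvd_card_of_iterate_free (fun ω : ℕ → Site (d + 2) => fun i => rho d (ω i)) (by omega) _ ?_ ?_ ?_
  · intro ω hω
    obtain ⟨h1, h2⟩ := Finset.mem_filter.1 hω
    exact Finset.mem_filter.2 ⟨comp_rho_mem_irreducibleBridges d h1, by rw [costZd_comp_rho, h2]⟩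
  · intro ω _
    have hit : ∀ k, (fun ω : ℕ → Site (d + 2) => fun i => rho d (ω i))^[k] ω = fun i => (rho d)^[k] (ω i) := by
      intro k
      induction k with
      | zero => rfl
      | succ k ih => rw [Function.iterate_succ_apply', ih]; funext i; rw [Function.iterate_succ_apply']
    rw [hit]; funext i; exact rho_iterate_two_mul d (ω i)
  · intro ω hω k hk0 hk hfix
    obtain ⟨h1, h2⟩ := Finset.mem_filter.1 hω
    have hit : ∀ k, (fun ω : ℕ → Site (d + 2) => fun i => rho d (ω i))^[k] ω = fun i => (rho d)^[k] (ω i) := by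
      intro k
      induction k with
      | zero => rfl
      | succ k ih => rw [Function.iterate_succ_apply', ih]; funext i; rw [Function.iterate_succ_apply']
    rw [hit] at hfix
    obtain ⟨i, -, j, hj⟩ := exists_lateral_step d h1 (by rw [h2]; exact hc)
    have h3 := congrFun hfix (i + 1)
    have h4 := congrFun hfix i
    have : (rho d)^[k] (ω (i + 1) - ω i) = ω (i + 1) - ω i := by rw [rho_iterate_sub, h3, h4]
    rw [hj] at this
    exact rho_iterate_latUnit_ne d hk0 hk j this

/-- In one dimension there is no lateral axis: every cost cell with `c ≥ 1` vanishes. [cite: MadrasSlade1993, §4.2, eq. (4.2.20)–(4.2.22) (p. 94, 2013 reprint)] -/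
theorem costCoeffZd_zero_dim_eq_zero {c : ℕ} (hc : 1 ≤ c) (n : ℕ) : costCoeffZd 0 c n = 0 := by
  classical
  rw [costCoeffZd, Finset.card_eq_zero, Finset.filter_eq_empty_iff]
  intro ω hω hcost
  have hfix : (fun i => latNeg 0 (ω i)) = ω := by
    funext i a
    have : a = 0 := Fin.ext (by have := a.isLt; omega)
    subst this; simp
  have := costZd_eq_zero_of_latNeg_fixed 0 hω hfix
  omega

/-- ★★ **`2d ∣ N_{c,n}(ℤ^{d+1})` for every `c ≥ 1`, every `n`, every `d`.** [cite: MadrasSlade1993, §4.2, eq. (4.2.20)–(4.2.22) (p. 94, 2013 reprint)] -/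
theorem two_mul_dvd_costCoeffZd (d : ℕ) {c : ℕ} (hc : 1 ≤ c) (n : ℕ) : 2 * d ∣ costCoeffZd d c n := by
  cases d with
  | zero => simp [costCoeffZd_zero_dim_eq_zero hc]
  | succ d => exact two_mul_dvd_costCoeffZd_succ d hc n

/-- ★★★ **`2d ∣ c_k^{(d)}` FOR EVERY `k ≥ 1` AND EVERY DIMENSION**: the first-order factor `2d` (`c₁^{(d)} = 2d`) divides every coefficient of the
large-force expansion `e^{λ_B(y)} = y Σ_k c_k^{(d)} y^{−k}` of the pulled self-avoiding walk on `ℤ^{d+1}`. [cite: JansevanRensburgWhittington2013, §3.2 Theorem 8 (arXiv v4 p. 11)] -/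
theorem two_mul_dvd_largeForceCoeffZd (d : ℕ) {k : ℕ} (hk : 1 ≤ k) : (2 * d : ℤ) ∣ largeForceCoeffZd d k :=
  CostSeries.dvd_e_of_dvd_census (costCoeffZd d) (2 * d) (fun c hc n => by exact_mod_cast two_mul_dvd_costCoeffZd d hc n) hk

end Literature.Probability.RandomPlanarGeometry.SAW.Zd

end
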